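import Mathlib
import Summits.Ventures.PercRepro2.TypedSpineSt

/-!
# Typed edges away from the roots are free (blind cell PercRepro2, p2 g0, 2026-08-25; sub-claim S1,
`proofs/subclaims/S1-REDUCTION.md`, the ninth rule of the calculus)

The state of a configuration (`st`: `a₂ ↔ a₁`, and the root connections of `o, b, a₃`) is a
function of the connections FROM THE TWO ROOTS. Hence a typed edge `e` whose ends are reachable from
neither root in the open graph `z ∪ F` (every edge of `F` open, the pinned-open edges open) never
changes a state: every copy may carry it or not, the kernel does not see it, and the typed count
factors — `N_τ = C(3, τ e) · N_{τ[e := 0]}` (`typedCount_free_edge_st`, for every state kernel;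
`typedCount_free_edge` for `K₃`). This is the «unmarked component» rule of
`LEAD-TYPED-REDUCTION.md` §2 sharpened: not only mark-free components, every typed edge outside
the two root components is free.

Consequence for the residual class of S1: `ReducedR` := `Reduced` ∧ every typed edge has an end
reachable from a root in the typed graph `(V, F)`; `ResidualR` := `Residual` ∧ the same; the spine
`typedCount_nonneg_of_residualR` (the S1 induction with the ninth rule) gives (TRI) from (TRI) on
`ResidualR`, and **`HCov_all_of_residualConR_all`**: the crux of record from (TRI) on the
root-connected residual instances whose typed graph is CONNECTED (`ResidualConR`: `a₁ ↔ a₂` in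
`(V, F)` and every typed edge reachable from the roots). Own code; standard axioms.
-/

namespace Summit.Ventures.PercRepro2

open UnionCluster

namespace CovForm

namespace TypedRed

open OneTyped Untouched

/-! ## Connections do not cross an edge that no root reaches -/

section ConnFree

variable {V : Type*} {E : Type*} [DecidableEq E]

/-- If `m` reaches neither end of `e` in `y ≥ x'`, closing `e` in `x'` does not change what `m`
reaches. -/
lemma conn_update_false_iff {ends : E → Sym2 V} {x' y : Config E} (hxy : x' ≤ y) {e : E}
    {m : V} (hfree : ∀ p ∈ ends e, ¬ Conn ends y m p) (v : V) :
    Conn ends x' m v ↔ Conn ends (Function.update x' e false) m v := by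
  constructor
  · intro h
    let S : Set V := {w | Conn ends (Function.update x' e false) m w}
    have hS : ∀ w ∈ S, ∀ w', (openGraph ends x').Adj w w' → w' ∈ S := by
      intro w hw w' hww'
      obtain ⟨_, e', he', hends⟩ := openGraph_adj.1 hww'
      by_cases hee : e' = e
      · subst hee
        exfalso
        apply hfree w
        · rw [hends]; exact Sym2.mem_mk_left _ _
        · exact conn_mono (le_trans (fun g => by
            by_cases hg : g = e'
            · subst hg; simp
            · simp [Function.update_of_ne hg]) hxy) hw
      · have he'' : Function.update x' e false e' = true := by
          rw [Function.update_of_ne hee]; exact he'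
        exact conn_trans hw (conn_of_openAdj ⟨e', he'', hends⟩)
    exact mem_of_conn_of_closed hS (conn_refl _ _ _) h
  · intro h
    exact conn_mono (fun g => by
      by_cases hg : g = e
      · subst hg; simp
      · simp [Function.update_of_ne hg]) h

end ConnFree

/-! ## The state ignores a typed edge away from the roots -/

section StateFree

variable {V : Type*} {E : Type*} [DecidableEq E]
variable (ends : E → Sym2 V) (o a₁ a₂ a₃ b : V)

/-- The open graph `z ∪ F`. -/
def openF (F : Finset E) (z : Config E) : Config E := fun e => z e || decide (e ∈ F)

/-- A configuration agreeing with `z` off `F` lies below `z ∪ F`. -/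
lemma le_openF {F : Finset E} {z x : Config E} (hx : ∀ e, e ∉ F → x e = z e) : x ≤ openF F z := by
  intro e
  by_cases he : e ∈ F
  · simp [openF, he]
  · by_cases hz : z e = true <;> simp [openF, hx e he, hz]

/-- A typed edge is open in `z ∪ F`. -/
lemma openF_of_mem {F : Finset E} {z : Config E} {e : E} (he : e ∈ F) : openF F z e = true := by
  simp [openF, he]

/-- **The state ignores a typed edge reached by neither root**: if `x` agrees with `z` off `F`,
`e ∈ F`, and no root reaches an end of `e` in `z ∪ F`, the state of `x[e ↦ c]` is that of
`x[e ↦ false]`. -/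
lemma st_update_free {F : Finset E} {z : Config E} {e : E} (he : e ∈ F)
    (hfree : ∀ p ∈ ends e, ¬ Conn ends (openF F z) a₁ p ∧ ¬ Conn ends (openF F z) a₂ p)
    {x : Config E} (hx : ∀ e', e' ∉ F → x e' = z e') (c : Bool) :
    st ends o a₁ a₂ a₃ b (Function.update x e c) = st ends o a₁ a₂ a₃ b (Function.update x e false) := by
  have hle : Function.update x e c ≤ openF F z := by
    intro g
    by_cases hg : g = e
    · subst hg; rw [openF_of_mem he]; simp
    · rw [Function.update_of_ne hg]; exact le_openF hx g
  have h1 := fun v => conn_update_false_iff hle (fun p hp => (hfree p hp).1) v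
  have h2 := fun v => conn_update_false_iff hle (fun p hp => (hfree p hp).2) v
  have hidem : Function.update (Function.update x e c) e false = Function.update x e false :=
    Function.update_idem _ _ _
  rw [hidem] at h1 h2
  unfold st
  simp only [Prod.mk.injEq]
  exact ⟨decide_eq_decide.mpr (h2 a₁), decide_eq_decide.mpr (h1 o), decide_eq_decide.mpr (h2 o),
    decide_eq_decide.mpr (h1 b), decide_eq_decide.mpr (h2 b), decide_eq_decide.mpr (h1 a₃),
    decide_eq_decide.mpr (h2 a₃)⟩

end StateFree

/-! ## The free-edge rule -/

section FreeRule

variable {V : Type*} {E : Type*} [Fintype E] [DecidableEq E] {R : Type*} [Field R]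
variable (ends : E → Sym2 V) (o a₁ a₂ a₃ b : V)

/-- **Free typed edge (rule (f))** for a state kernel: a typed edge reached by neither root in
`z ∪ F` contributes the factor `C(3, τ e)`: `N_τ = C(3, τ e) · N_{τ[e := 0]}`. -/
theorem typedCount_free_edge_st (KK : St → St → St → R) (F : Finset E) {e : E} (he : e ∈ F)
    (z : Config E)
    (hfree : ∀ p ∈ ends e, ¬ Conn ends (openF F z) a₁ p ∧ ¬ Conn ends (openF F z) a₂ p)
    (τ : E → ℕ) :
    typedCount F z τ (stKer ends o a₁ a₂ a₃ b KK) =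
      (Nat.choose 3 (τ e) : R) * typedCount F z (Function.update τ e 0) (stKer ends o a₁ a₂ a₃ b KK) := by
  have hinv : ∀ (p q r : Bool), typedCount (F.erase e) (Function.update z e false) τ
      (fun x y w => stKer ends o a₁ a₂ a₃ b KK (Function.update x e p) (Function.update y e q)
        (Function.update w e r)) =
      typedCount (F.erase e) (Function.update z e false) τ
        (fun x y w => stKer ends o a₁ a₂ a₃ b KK (Function.update x e false)
          (Function.update y e false) (Function.update w e false)) := by
    intro p q r
    refine typedCount_congr_K_on _ _ _ fun x y w hxyw _ => ?_
    have hx : ∀ e', e' ∉ F → x e' = z e' := fun e' he' => by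
      have := (hxyw e' (fun h => he' (Finset.mem_of_mem_erase h))).1
      rwa [Function.update_of_ne (fun h : e' = e => he' (h ▸ he))] at this
    have hy : ∀ e', e' ∉ F → y e' = z e' := fun e' he' => by
      have := (hxyw e' (fun h => he' (Finset.mem_of_mem_erase h))).2.1
      rwa [Function.update_of_ne (fun h : e' = e => he' (h ▸ he))] at this
    have hw : ∀ e', e' ∉ F → w e' = z e' := fun e' he' => by
      have := (hxyw e' (fun h => he' (Finset.mem_of_mem_erase h))).2.2
      rwa [Function.update_of_ne (fun h : e' = e => he' (h ▸ he))] at this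
    unfold stKer
    rw [st_update_free ends o a₁ a₂ a₃ b he hfree hx p, st_update_free ends o a₁ a₂ a₃ b he hfree hy q,
      st_update_free ends o a₁ a₂ a₃ b he hfree hw r]
  rw [typedCount_split F e he, typedCount_split_zero F e he]
  simp only [hinv]
  exact sum_bool3_choose (τ e) _

/-- **Free typed edge (rule (f)) for `K₃`.** -/
theorem typedCount_free_edge (F : Finset E) {e : E} (he : e ∈ F) (z : Config E)
    (hfree : ∀ p ∈ ends e, ¬ Conn ends (openF F z) a₁ p ∧ ¬ Conn ends (openF F z) a₂ p)
    (τ : E → ℕ) :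
    typedCount F z τ (K3 ends o a₁ a₂ a₃ b : Config E → Config E → Config E → R) =
      (Nat.choose 3 (τ e) : R) * typedCount F z (Function.update τ e 0) (K3 ends o a₁ a₂ a₃ b) := by
  rw [K3_eq_stKer]
  exact typedCount_free_edge_st ends o a₁ a₂ a₃ b _ F he z hfree τ

end FreeRule

end TypedRed

end CovForm

end Summit.Ventures.PercRepro2
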